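import Literature.NumberTheory.LFunctions.Zhang2022.Section10Lemma102Model
import Literature.NumberTheory.LFunctions.Zhang2022.Section8Lemma84SmallRect
import HarnessLib

/-!
# Zhang (2022), Lemma 10.2 — the small rectangle at shift `β_μ = 0`: integrand versus the
# triple-pole model

Topic `Literature/NumberTheory/LFunctions/Zhang2022` (Landau–Siegel audit tree; verdict-neutral).
Y. Zhang, *Discrete mean estimates and the Landau–Siegel zero*, arXiv:2211.02515v1 (2022)
[Zhang2022LandauSiegel] — **an unrefereed manuscript under adjudication**; DAG nodes `Z22:Lem10.2.pf`,
`Z22:§10.u019/u021/u022` [Z22 p.56, tex L2824–L2851] ("The contour of integration is moved in the same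
way as the proof of Lemma 8.1. Thus, by Lemma 5.8 and 8.2 …"). ZHANG-L discharge lane (WP10), the
`β_μ = 0` companion of sz-d27's `Section8Lemma84SmallRect` (the shift-0 model and its residue are
sz-d43's `Section10Lemma102Model`).

After the tent decomposition (`Section10Lemma102Tent`) the sum `𝔳₂ⱼ(d,r)` of Lemma 10.2 is a
combination of the untwisted log-means `A(x) = Σ_{n≤x} χ(n)ξ₀ⱼ(n;d,r)n⁻¹log(x/n)`, whose Perron
integrand is `G(u) = e^{uL}Φ(u)/u²`, `Φ(u) = 𝔲(1+u)L(1+u+β_a)L(1+u+β_b)/L(1+u)`, `L = log x`. On the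
boundary of the small rectangle `R_s = [−α/2, α/2] × [−3α, 3α]` one has `|u| ≥ α/2`, so a pointwise
comparison `‖Φ(u) − M₀(u+β_a)(u+β_b)/u‖ ≤ Δ` (Lemma 5.8 + Lemma 8.3, file `Section10Lemma102Estimate0`)
gives `‖G − G₀‖ ≤ 4e^{αL/2}Δ/α²` against the model `G₀(u) = M₀e^{uL}(u+β_a)(u+β_b)/u³`, whose boundary
integral is EXACTLY `2πi·M₀(1 + (β_a+β_b)L + ½β_aβ_bL²)` (`Lemma102.rectBoundaryIntegral_model0`);
the perimeter is `14α`. Result: `norm_rectSmall0_sub_main_le`.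

Nothing about the manuscript's Theorems 1–2 or about Landau–Siegel zeros is asserted.

## References

* Y. Zhang, arXiv:2211.02515v1 (2022), §10 Lemma 10.2 (proof), §8 Lemma 8.4 (proof).
  [cite: Zhang2022LandauSiegel, §10 Lemma 10.2]
* J. B. Conway, *Functions of One Complex Variable I*, GTM 11, Ch. V §2. [cite: Conway1978, V.2.2]
-/

noncomputable section

open Complex Real Set MeasureTheory Filter Topology

namespace Literature.NumberTheory.LFunctions.Zhang2022.Lemma102

open Literature.Analysis.Complex

section SmallRect0

variable {Φ G : ℂ → ℂ} {M₀ βa βb : ℂ} {L α Δ : ℝ}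

/-- Real and imaginary part of the boundary parametrisation `x + iy`. [folklore] -/
private theorem re_im_pt0 (x y : ℝ) : ((x : ℂ) + y * I).re = x ∧ ((x : ℂ) + y * I).im = y := by
  constructor <;> simp

/-- **Geometry of `∂R_s` at shift `0`**: a boundary point `u` of `R_s = [−α/2, α/2] × [−3α, 3α]`
has `|u| ≥ α/2`, `Re u ≤ α/2` and `u ≠ 0`. [cite: Zhang2022LandauSiegel, §10 Lemma 10.2 (proof)] -/
theorem bdry_facts0 (hα : 0 < α) {u : ℂ} (hre : u.re ∈ Icc (-(α / 2)) (α / 2))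
    (hbd : |u.re| = α / 2 ∨ |u.im| = 3 * α) :
    α / 2 ≤ ‖u‖ ∧ u.re ≤ α / 2 ∧ u ≠ 0 := by
  have hnorm : α / 2 ≤ ‖u‖ := by
    rcases hbd with h | h
    · calc α / 2 = |u.re| := h.symm
        _ ≤ ‖u‖ := Complex.abs_re_le_norm u
    · have him : α / 2 ≤ |u.im| := by rw [h]; linarith
      exact him.trans (Complex.abs_im_le_norm u)
  refine ⟨hnorm, hre.2, ?_⟩
  intro h0
  rw [h0, norm_zero] at hnorm
  linarith

/-- **The small rectangle at shift `0`: integrand versus model.** Let `G(u) = e^{uL}Φ(u)/u²`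
(`L ≥ 0`, `α > 0`) and suppose that at every boundary point `u` of `R_s = [−α/2, α/2] × [−3α, 3α]` the
function `G` is continuous and `‖Φ(u) − M₀(u+β_a)(u+β_b)/u‖ ≤ Δ`. Then
`‖∮_{∂R_s} G − 2πi·M₀(1 + (β_a+β_b)L + ½β_aβ_bL²)‖ ≤ 56·e^{αL/2}·Δ/α` — the model's boundary integral
is exactly the residue at the triple pole (`Lemma102.rectBoundaryIntegral_model0`), and on `∂R_s`,
`‖G − G₀‖ ≤ e^{αL/2}Δ·4/α²`, perimeter `14α`. [cite: Zhang2022LandauSiegel, §10 Lemma 10.2 (proof)]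
[cite: Conway1978, V.2.2] -/
theorem norm_rectSmall0_sub_main_le (hα : 0 < α) (hL : 0 ≤ L)
    (hG : ∀ u, G u = cexp (u * (L : ℂ)) * Φ u / u ^ 2)
    (hΔ : ∀ u : ℂ, u.re ∈ Icc (-(α / 2)) (α / 2) → u.im ∈ Icc (-(3 * α)) (3 * α) →
      (|u.re| = α / 2 ∨ |u.im| = 3 * α) →
      ‖Φ u - M₀ * (u + βa) * (u + βb) / u‖ ≤ Δ)
    (hGc : ∀ u : ℂ, u.re ∈ Icc (-(α / 2)) (α / 2) → u.im ∈ Icc (-(3 * α)) (3 * α) →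
      (|u.re| = α / 2 ∨ |u.im| = 3 * α) → ContinuousAt G u) :
    ‖rectBoundaryIntegral G (-(α / 2)) (α / 2) (-(3 * α)) (3 * α) -
        2 * π * I * (M₀ * (1 + (βa + βb) * (L : ℂ) + βa * βb * (L : ℂ) ^ 2 / 2))‖ ≤
      56 * Real.exp (α * L / 2) * Δ / α := by
  -- the model integrand and its boundary integral
  set G₀ : ℂ → ℂ := fun u : ℂ => M₀ * cexp (u * (L : ℂ)) * ((u + βa) * (u + βb)) / u ^ 3 with hG₀
  have hab : -(α / 2) < α / 2 := by linarith
  have hcd : -(3 * α) < 3 * α := by linarith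
  have h0in : (0 : ℂ) ∈ Ioo (-(α / 2)) (α / 2) ×ℂ Ioo (-(3 * α)) (3 * α) := by
    refine ⟨⟨?_, ?_⟩, ?_, ?_⟩ <;> simp only [Complex.zero_re, Complex.zero_im] <;> linarith
  have hmodel : rectBoundaryIntegral G₀ (-(α / 2)) (α / 2) (-(3 * α)) (3 * α) =
      2 * π * I * (M₀ * (1 + (βa + βb) * (L : ℂ) + βa * βb * (L : ℂ) ^ 2 / 2)) :=
    rectBoundaryIntegral_model0 M₀ βa βb (L : ℂ) hab hcd h0in
  -- the difference on the boundary
  set F : ℂ → ℂ := fun u => G u - G₀ u with hF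
  set Mb : ℝ := Real.exp (α * L / 2) * (4 / α ^ 2) * Δ with hMb
  have hbd : ∀ u : ℂ, u.re ∈ Icc (-(α / 2)) (α / 2) →
      u.im ∈ Icc (-(3 * α)) (3 * α) → (|u.re| = α / 2 ∨ |u.im| = 3 * α) →
      ‖F u‖ ≤ Mb ∧ ContinuousAt F u ∧ ContinuousAt G₀ u := by
    intro u hre him hb
    obtain ⟨hnorm, hre2, hu0⟩ := bdry_facts0 hα hre hb
    have hu2 : u ^ 2 ≠ 0 := pow_ne_zero 2 hu0
    have hu3 : u ^ 3 ≠ 0 := pow_ne_zero 3 hu0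
    have hG₀c : ContinuousAt G₀ u := (differentiableAt_model0 M₀ βa βb (L : ℂ) hu0).continuousAt
    refine ⟨?_, (hGc u hre him hb).sub hG₀c, hG₀c⟩
    have hFu : F u = cexp (u * (L : ℂ)) / u ^ 2 * (Φ u - M₀ * (u + βa) * (u + βb) / u) := by
      simp only [hF, hG₀, hG u]
      field_simp
    have hexp : ‖cexp (u * (L : ℂ))‖ ≤ Real.exp (α * L / 2) := by
      rw [Complex.norm_exp]
      have : (u * (L : ℂ)).re = u.re * L := by simp [Complex.mul_re]
      rw [this, Real.exp_le_exp]
      calc u.re * L ≤ α / 2 * L := mul_le_mul_of_nonneg_right hre2 hL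
        _ = α * L / 2 := by ring
    have husq : (α / 2) ^ 2 ≤ ‖u ^ 2‖ := by
      rw [norm_pow]; exact pow_le_pow_left₀ (by positivity) hnorm 2
    have hΔu := hΔ u hre him hb
    rw [hFu, norm_mul, norm_div]
    calc ‖cexp (u * (L : ℂ))‖ / ‖u ^ 2‖ * ‖Φ u - M₀ * (u + βa) * (u + βb) / u‖
        ≤ Real.exp (α * L / 2) / (α / 2) ^ 2 * Δ := by gcongr
      _ = Mb := by rw [hMb]; field_simp; ring
  -- boundary points of the four sides
  have hbot : ∀ x ∈ Icc (-(α / 2)) (α / 2),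
      ((x : ℂ) + (-(3 * α) : ℝ) * I).re ∈ Icc (-(α / 2)) (α / 2) ∧
      ((x : ℂ) + (-(3 * α) : ℝ) * I).im ∈ Icc (-(3 * α)) (3 * α) ∧
      (|((x : ℂ) + (-(3 * α) : ℝ) * I).re| = α / 2 ∨
        |((x : ℂ) + (-(3 * α) : ℝ) * I).im| = 3 * α) := by
    intro x hx
    obtain ⟨h1, h2⟩ := re_im_pt0 x (-(3 * α))
    rw [h1, h2]
    refine ⟨hx, ⟨le_rfl, by linarith⟩, Or.inr ?_⟩
    rw [abs_neg, abs_of_pos (by positivity)]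
  have htop : ∀ x ∈ Icc (-(α / 2)) (α / 2),
      ((x : ℂ) + (3 * α : ℝ) * I).re ∈ Icc (-(α / 2)) (α / 2) ∧
      ((x : ℂ) + (3 * α : ℝ) * I).im ∈ Icc (-(3 * α)) (3 * α) ∧
      (|((x : ℂ) + (3 * α : ℝ) * I).re| = α / 2 ∨
        |((x : ℂ) + (3 * α : ℝ) * I).im| = 3 * α) := by
    intro x hx
    obtain ⟨h1, h2⟩ := re_im_pt0 x (3 * α)
    rw [h1, h2]
    refine ⟨hx, ⟨by linarith, le_rfl⟩, Or.inr ?_⟩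
    rw [abs_of_pos (by positivity)]
  have hleft : ∀ y ∈ Icc (-(3 * α)) (3 * α),
      (((-(α / 2) : ℝ) : ℂ) + y * I).re ∈ Icc (-(α / 2)) (α / 2) ∧
      (((-(α / 2) : ℝ) : ℂ) + y * I).im ∈ Icc (-(3 * α)) (3 * α) ∧
      (|(((-(α / 2) : ℝ) : ℂ) + y * I).re| = α / 2 ∨
        |(((-(α / 2) : ℝ) : ℂ) + y * I).im| = 3 * α) := by
    intro y hy
    obtain ⟨h1, h2⟩ := re_im_pt0 (-(α / 2)) y
    rw [h1, h2]
    refine ⟨⟨le_rfl, by linarith⟩, hy, Or.inl ?_⟩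
    rw [abs_neg, abs_of_pos (by positivity)]
  have hright : ∀ y ∈ Icc (-(3 * α)) (3 * α),
      (((α / 2 : ℝ) : ℂ) + y * I).re ∈ Icc (-(α / 2)) (α / 2) ∧
      (((α / 2 : ℝ) : ℂ) + y * I).im ∈ Icc (-(3 * α)) (3 * α) ∧
      (|(((α / 2 : ℝ) : ℂ) + y * I).re| = α / 2 ∨
        |(((α / 2 : ℝ) : ℂ) + y * I).im| = 3 * α) := by
    intro y hy
    obtain ⟨h1, h2⟩ := re_im_pt0 (α / 2) y
    rw [h1, h2]
    refine ⟨⟨by linarith, le_rfl⟩, hy, Or.inl ?_⟩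
    rw [abs_of_pos (by positivity)]
  -- `∮ G = ∮ F + ∮ G₀`
  have hsplit : rectBoundaryIntegral G (-(α / 2)) (α / 2) (-(3 * α)) (3 * α) =
      rectBoundaryIntegral F (-(α / 2)) (α / 2) (-(3 * α)) (3 * α) +
        rectBoundaryIntegral G₀ (-(α / 2)) (α / 2) (-(3 * α)) (3 * α) := by
    have h := rectBoundaryIntegral_add (F := F) (G := G₀) hab.le hcd.le
      (fun x hx => (hbd _ (hbot x hx).1 (hbot x hx).2.1 (hbot x hx).2.2).2.1)
      (fun x hx => (hbd _ (htop x hx).1 (htop x hx).2.1 (htop x hx).2.2).2.1)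
      (fun y hy => (hbd _ (hleft y hy).1 (hleft y hy).2.1 (hleft y hy).2.2).2.1)
      (fun y hy => (hbd _ (hright y hy).1 (hright y hy).2.1 (hright y hy).2.2).2.1)
      (fun x hx => (hbd _ (hbot x hx).1 (hbot x hx).2.1 (hbot x hx).2.2).2.2)
      (fun x hx => (hbd _ (htop x hx).1 (htop x hx).2.1 (htop x hx).2.2).2.2)
      (fun y hy => (hbd _ (hleft y hy).1 (hleft y hy).2.1 (hleft y hy).2.2).2.2)
      (fun y hy => (hbd _ (hright y hy).1 (hright y hy).2.1 (hright y hy).2.2).2.2)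
    have he : (fun z => F z + G₀ z) = G := by
      funext z; simp only [hF, sub_add_cancel]
    rw [he] at h
    exact h
  -- the perimeter bound for `F`
  have hper := norm_rectBoundaryIntegral_le (F := F) hab.le hcd.le (M := Mb)
    (fun x hx => (hbd _ (hbot x hx).1 (hbot x hx).2.1 (hbot x hx).2.2).1)
    (fun x hx => (hbd _ (htop x hx).1 (htop x hx).2.1 (htop x hx).2.2).1)
    (fun y hy => (hbd _ (hleft y hy).1 (hleft y hy).2.1 (hleft y hy).2.2).1)
    (fun y hy => (hbd _ (hright y hy).1 (hright y hy).2.1 (hright y hy).2.2).1)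
  rw [hsplit, hmodel, add_sub_cancel_right]
  refine hper.trans (le_of_eq ?_)
  rw [hMb]
  field_simp
  ring

end SmallRect0

end Literature.NumberTheory.LFunctions.Zhang2022.Lemma102
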